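/-
Copyright (c) 2026 the pub-hodgecm-mathlib formalisation cell (harness21).  Prover seat hodgecm-mathlib-LH1-p03 (g5): line LH3 (closer stub `stub_N9`), letter L1
clause (I₃) ALL ORDERS, brick (B-wick) «cofactor Wick identity» (F0P3a-p08 (g23) SPEC-I3 v1.1 §5 + bus word 2026-09-02T10:09:49Z (2)); 2026-09-02.
-/
import Literature.NumberTheory.Rogawski1990.ArchOrbFamGExtWallFactorSmooth   -- ★ p850943∕p850964 (this seat): `contDiff_wallFactorR`, `wallFactorR_zero_eq`, `wallFactorR_zero_ne_zero_of_hcSemireg`; brings ★ (c-wall) `archERhoG_mul_archRG_add_smul_hcNrm_eq`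
import Literature.NumberTheory.Rogawski1990.ArchCayleyValueOfMembership     -- ★ p850419 (LH4-p01 (g3)): the `x`-ray `hcCayPt w i j p + x • e_{w,0}` (`cayRay_apply_self_zero∕one∕two`, `cayRay_apply_of_ne`)
import Literature.Analysis.Calculus.CosCoshWickJets                          -- ★ (this seat, generic layer): `coe_circleExp_mul_one_sub_mul_one_sub_eq_two_cos_sub`, `norm_mul_norm_eq_two_cosh_sub_two_cos`, `iteratedDeriv_ofReal_two_cos_sub_zero_eq_I_pow_mul`, `contDiff_ofReal_two_cosh_sub`
import HarnessLib

/-!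
# (B-wick) The cofactor Wick identity: the `ν`-jets of the compact wall factor `R` at the wall are `i^{a+1}` times the `x`-jets of the split wall factor `R♯` at the Cayley point
# (Shelstad 1979 §4 Lemma 4.3, Prop. 4.5; Rogawski 1990 §8.2 pp. 118–124; Varadarajan 1989 §6.4 Thm 24)

Topic `NumberTheory/Rogawski1990`; namespace `Literature.NumberTheory.Rogawski1990`.  THEOREMS ONLY (no definition, no instance, no notation, no axiom, no named fact, no
`sorry`); group-free and measure-free (an index type `W` of places); kernel lane `--kind proof --supports stmt-HodgeConjecture-24833`.  Cell `pub/hodgecm-mathlib` (D-0151),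
crux H413 = `stmt-HodgeConjecture-24833`, F0∕P3c line LH3 (closer stub `stub_N9`, DIRECT ROAD `F0_P3c_StubN9Direct`), letter L1 `HcOrbitalFamiliesStatement`, clause (I₃)
`ArchHcJump` AT ALL ORDERS (LH3-plan (g3) RULING #14∕#16; spec of record F0P3a-p08 (g23) `SPEC-I3-jumps` v1.1, (S1) demoted to a rider 10:09:49Z ⇒ the `m`-form
`e^{ρ}·R′·orbFamGExt = (K·R p ν)·F_f(ν)` binds and (B-wick) is REQUIRED): brick **(B-wick)**, sibling of ★ (B-desc-R) `ArchOrbFamGExtWallFactorSmooth`.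
HONEST LABEL: HC_CM is proved only modulo the 7 printed citations (2 remaining named inputs: hLiu418 = `stmt-HodgeConjecture-24832`, h413 = `stmt-HodgeConjecture-24833`) until
rung 0 closes; count-neutral one-variable calculus and trigonometry (no stub closes by this file alone).

THE MATHEMATICS.  At a wall point `p` of the compact chart `S` (`w ∉ S`, `θ = p w 0 = p w 2`, `φ = p w 1`) the two normalised families of (I₃) carry root cofactors:
along the NORMAL `p + ν·hcNrm w 0 2`, `e^{ρ}·R′ = 2 sin ν · R p ν` with `R p ν = i·e^{iν}(1 − e^{i(φ−θ−ν)})(1 − e^{i(θ−ν−φ)})·Π p = i·(2cos ν − 2cos(θ−φ))·Π p` (★ (c-wall)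
:54, generic layer); along the `x`-RAY `hcCayPt w 0 2 p + x·e_{w,0}` of the split chart `insert w S`, `e^{ρ}·R′ = |eˣ − e⁻ˣ| · R♯ p x` with
`R♯ p x = ‖e^{x+iθ} − e^{iφ}‖·‖e^{−x+iθ} − e^{iφ}‖·Π p = (2cosh x − 2cos(θ−φ))·Π p` (§1, §3: the product of the two complex-root factors is `e^{i(θ+φ)}(2cos(θ−φ) − 2cosh x)`),
with the SAME frozen product `Π p` over `w′ ≠ w` (`e^{ρ}`-factors folded in) — Harish-Chandra's cofactor read on the two real forms `ν ↦ e^{iν}`, `x ↦ eˣ` of one complex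
torus (SPEC-I3 (S1)).  Writing `2cos ν = e^{iν} + e^{−iν}`, `2cosh x = eˣ + e⁻ˣ` (§2): `(2cos ν − 2cos δ)⁽ᵃ⁾(0) = iᵃ + (−i)ᵃ − [a=0]·2cos δ = iᵃ·(2cosh x − 2cos δ)⁽ᵃ⁾(0)`, so
  **`iteratedDeriv a (R p) 0 = i^{a+1} · iteratedDeriv a (R♯ p) 0`**  (all `a`; both sides vanish for odd `a`; `R p 0 ∕ R♯ p 0 = i`)
— the (B-wick) input of the termwise match (B-jc) between (B-norm)'s Leibniz expansion `Σ_j C(n,j)·(K·R p)⁽ʲ⁾(0)·J_{n−j}` (compact chart) and `∂ₓⁿ(K″·R♯ p·Λ_f)(0)`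
(Cayley chart), which makes ONE jump constant `jc′ S w 0 2` serve every order `n` with `hcCayScalar = i^{#normal letters}`.

WHAT IS PROVED (the trigonometry `2cos ν − 2cos δ` ∕ `2cosh x − 2cos δ` and the jet identity `(2cos)⁽ᵃ⁾(0) = iᵃ(2cosh)⁽ᵃ⁾(0)` are the GENERIC layer ★ `Literature.Analysis.Calculus.CosCoshWickJets`).
* §3 (the `x`-ray of the split chart) `cayRay_eq_update`, `archERhoG_insert_cayRay_eq`, **`archERhoG_mul_archRG_cayRay_eq`** (`e^{ρ}·R′(cay_x) = |eˣ − e⁻ˣ|·R♯ p x`, the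
  split-chart twin of ★ (c-wall) :54), **`archERhoG_mul_splitCofactor_eq_splitWallFactorR`** (`e^{ρ}(c)·C(c) = R♯ p x` at any ray point, incl. `x = 0` — the `R″` bridge of (B-desc-hyp)).
* §4 (closed forms) **`wallFactorR_eq_two_cos_sub`**, **`splitWallFactorR_eq_two_cosh_sub`** (so SPEC §5's `R″ p x = (2cosh x − 2cos(p w 0 − p w 1))·Π p` IS `R♯ p x`),
  `contDiff_splitWallFactorR`, `I_mul_splitWallFactorR_zero_eq` (`i·R♯ p 0 = R p 0`), `splitWallFactorR_zero_ne_zero_of_hcSemireg`.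
* §5 (B-wick) **`iteratedDeriv_wallFactorR_zero_eq`** (`= I ^ (a + 1) * iteratedDeriv a (R♯ p) 0`) and **`wallFactorR_zero_div_splitWallFactorR_zero_eq_I`** (`R p 0 ∕ R♯ p 0 = I`);
  F0P3a-p08 (g23)'s shape `= I ^ a * (R p 0 ∕ R♯ p 0) * iteratedDeriv a (R♯ p) 0` is `by rw [wallFactorR_zero_div_splitWallFactorR_zero_eq_I S hp, iteratedDeriv_wallFactorR_zero_eq, pow_succ]`.

## References
* [Shelstad1979] D. Shelstad, *Characters and inner forms of a quasi-split group over ℝ*, Compositio Math. 39 (1979), §4 Lemma 4.3 p. 25 (`∂_n ↦ i∂_x`), Prop. 4.5 p. 26.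
* [Rogawski1990] J. D. Rogawski, *Automorphic Representations of Unitary Groups in Three Variables*, Ann. of Math. Stud. 123 (1990), §8.2 pp. 118–124 (p. 119, p. 122).
* [Varadarajan1989] V. S. Varadarajan, *An Introduction to Harmonic Analysis on Semisimple Lie Groups* (1989), §6.4 Thms 23–24 (matching of all jets at the wall).
-/

set_option autoImplicit false

noncomputable section

open Complex Set Function Real Filter Topology
open Literature.NumberTheory.Automorphic.ArchCartan Literature.Analysis.Calculus
open scoped ContDiff

namespace Literature.NumberTheory.Rogawski1990

/-! ## §3 The `x`-ray of the split chart through the Cayley point: `e^{ρ}·R′ = |eˣ − e⁻ˣ| · R♯` -/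

section Ray

variable {W : Type*} [Fintype W] [DecidableEq W]

omit [Fintype W] in
/-- The `x`-ray point is the update of `p` at `w` by `(x, φ, (θ₀+θ₂)∕2)`. [cite: Shelstad1979, §4 p. 25] -/
theorem cayRay_eq_update (p : W → Fin 3 → ℝ) (w : W) (x : ℝ) :
    hcCayPt w 0 2 p + x • (Pi.single w (Pi.single 0 1 : Fin 3 → ℝ) : W → Fin 3 → ℝ) = Function.update p w ![x, p w 1, (p w 0 + p w 2) / 2] := by
  funext w'
  by_cases hw' : w' = w
  · subst hw'
    rw [Function.update_self]
    funext l
    fin_cases l <;> simp [hcThird_zero_two]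
  · rw [cayRay_apply_of_ne p hw', Function.update_of_ne hw']

/-- `e^{ρ}_{S∪w}` is CONSTANT along the `x`-ray: `= ∏_{w′ ≠ w}(if w′ ∈ S then 1 else e^{i(p w′ 0 − p w′ 2)})` (★ `archERhoG_insert_update`, ★ `archERhoG_insert_hcCayPt_eq`'s value).
[cite: Shelstad1979, §4 p. 24; Lemma 4.3 (p. 25)] -/
theorem archERhoG_insert_cayRay_eq (S : Finset W) (w : W) (p : W → Fin 3 → ℝ) (x : ℝ) :
    archERhoG (insert w S) (hcCayPt w 0 2 p + x • (Pi.single w (Pi.single 0 1 : Fin 3 → ℝ) : W → Fin 3 → ℝ)) =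
      ∏ w' ∈ Finset.univ.erase w, (if w' ∈ S then (1 : ℂ) else (Circle.exp (p w' 0 - p w' 2) : ℂ)) := by
  rw [cayRay_eq_update, archERhoG_insert_update]
  unfold archERhoG
  rw [← Finset.mul_prod_erase Finset.univ _ (Finset.mem_univ w), if_pos (Finset.mem_insert_self w S), one_mul]
  refine Finset.prod_congr rfl fun w' hw' => ?_
  have hne : w' ≠ w := Finset.ne_of_mem_erase hw'
  by_cases hS : w' ∈ S
  · rw [if_pos (Finset.mem_insert_of_mem hS), if_pos hS]
  · rw [if_neg (fun h => (Finset.mem_insert.1 h).elim hne hS), if_neg hS]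

/-- **`e^{ρ}·R′` OF THE SPLIT CHART ALONG THE `x`-RAY = `|eˣ − e⁻ˣ| · R♯ p x`**, with
`R♯ p x = ‖e^{x+iθ} − e^{iφ}‖·‖e^{−x+iθ} − e^{iφ}‖ · Π p` (`θ = p w 0 = p w 2`, `φ = p w 1`; `Π p` = ★ (c-wall) :54's frozen product VERBATIM, the `e^{ρ}`-factors folded in) — the
split-chart twin of ★ `archERhoG_mul_archRG_add_smul_hcNrm_eq`; the `R″` text the Cayley-ray descent (B-desc-hyp) binds to. [cite: Shelstad1979, §4 p. 22; Lemma 4.3 (p. 25)]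
[cite: Rogawski1990, §8.2 pp. 118–119] -/
theorem archERhoG_mul_archRG_cayRay_eq (S : Finset W) {w : W} {p : W → Fin 3 → ℝ} (hp : p w 0 = p w 2) (x : ℝ) :
    archERhoG (insert w S) (hcCayPt w 0 2 p + x • (Pi.single w (Pi.single 0 1 : Fin 3 → ℝ) : W → Fin 3 → ℝ)) *
        archRG (insert w S) (hcCayPt w 0 2 p + x • (Pi.single w (Pi.single 0 1 : Fin 3 → ℝ) : W → Fin 3 → ℝ)) =
      ((|Real.exp x - Real.exp (-x)| : ℝ) : ℂ) *
        (((‖cexp (x + p w 0 * I) - cexp (p w 1 * I)‖ * ‖cexp (-x + p w 0 * I) - cexp (p w 1 * I)‖ : ℝ) : ℂ) *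
          ∏ w' ∈ Finset.univ.erase w,
            ((if w' ∈ S then (1 : ℂ) else (Circle.exp (p w' 0 - p w' 2) : ℂ)) *
              (if w' ∈ S then
                  ((|Real.exp (p w' 0) - Real.exp (-p w' 0)| *
                    ‖cexp (p w' 0 + p w' 2 * I) - cexp (p w' 1 * I)‖ * ‖cexp (-p w' 0 + p w' 2 * I) - cexp (p w' 1 * I)‖ : ℝ) : ℂ)
                else (1 - (Circle.exp (p w' 1 - p w' 0) : ℂ)) * (1 - (Circle.exp (p w' 2 - p w' 0) : ℂ)) * (1 - (Circle.exp (p w' 2 - p w' 1) : ℂ))))) := by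
  rw [archERhoG_insert_cayRay_eq, archRG_insert_eq_mul_prod_erase, cayRay_apply_self_zero, cayRay_apply_self_one, cayRay_apply_self_two, hcThird_zero_two,
    cayRay_eq_update, archRG_insert_update_prod_erase]
  have hmean : (p w 0 + p w 2) / 2 = p w 0 := by rw [← hp]; ring
  rw [hmean]
  -- the frozen factors: `w′ ∈ insert w S ↔ w′ ∈ S` for `w′ ≠ w`, then merge the `e^{ρ}` factors
  have hfro : (∏ w' ∈ Finset.univ.erase w,
      (if w' ∈ insert w S then
          ((|Real.exp (p w' 0) - Real.exp (-p w' 0)| *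
            ‖cexp (p w' 0 + p w' 2 * I) - cexp (p w' 1 * I)‖ * ‖cexp (-p w' 0 + p w' 2 * I) - cexp (p w' 1 * I)‖ : ℝ) : ℂ)
        else (1 - (Circle.exp (p w' 1 - p w' 0) : ℂ)) * (1 - (Circle.exp (p w' 2 - p w' 0) : ℂ)) * (1 - (Circle.exp (p w' 2 - p w' 1) : ℂ)))) =
      ∏ w' ∈ Finset.univ.erase w,
        (if w' ∈ S then
            ((|Real.exp (p w' 0) - Real.exp (-p w' 0)| *
              ‖cexp (p w' 0 + p w' 2 * I) - cexp (p w' 1 * I)‖ * ‖cexp (-p w' 0 + p w' 2 * I) - cexp (p w' 1 * I)‖ : ℝ) : ℂ)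
          else (1 - (Circle.exp (p w' 1 - p w' 0) : ℂ)) * (1 - (Circle.exp (p w' 2 - p w' 0) : ℂ)) * (1 - (Circle.exp (p w' 2 - p w' 1) : ℂ))) := by
    refine Finset.prod_congr rfl fun w' hw' => ?_
    have hne : w' ≠ w := Finset.ne_of_mem_erase hw'
    by_cases hS : w' ∈ S
    · rw [if_pos (Finset.mem_insert_of_mem hS), if_pos hS]
    · rw [if_neg (fun h => (Finset.mem_insert.1 h).elim hne hS), if_neg hS]
  rw [hfro, Finset.prod_mul_distrib]
  push_cast
  ring

/-- **`e^{ρ}_{S∪w}(c) · C(c) = R♯ p x` AT ANY POINT `c` OF THE `x`-RAY, INCLUDING `x = 0`** (`C` = ★ `archRG_insert_eq_absSub_mul_splitCofactor`'s cofactor; `c` given by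
its coordinates `c w = (x, φ, θ)`, `c w′ = p w′` — e.g. `c = hcCayPt w 0 2 p + x • e_{w,0}` via ★ `cayRay_apply_*`): the bridge from the split-chart reading
`orbFamGExt (insert w S) c = C(c) · K♯ · G` of (B-desc-hyp) to the `R″ = R♯` text, with NO division by `|eˣ − e⁻ˣ|`. [cite: Shelstad1979, Lemma 4.3 (p. 25)] [cite: Rogawski1990, §8.2 p. 119] -/
theorem archERhoG_mul_splitCofactor_eq_splitWallFactorR (S : Finset W) {w : W} {p c : W → Fin 3 → ℝ} {x : ℝ}
    (h0 : c w 0 = x) (h1 : c w 1 = p w 1) (h2 : c w 2 = p w 0) (hc : ∀ w', w' ≠ w → c w' = p w') :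
    archERhoG (insert w S) c *
        (((‖cexp (c w 0 + c w 2 * I) - cexp (c w 1 * I)‖ * ‖cexp (-c w 0 + c w 2 * I) - cexp (c w 1 * I)‖ : ℝ) : ℂ) *
          ∏ w' ∈ Finset.univ.erase w,
            (if w' ∈ insert w S then
                ((|Real.exp (c w' 0) - Real.exp (-c w' 0)| *
                  ‖cexp (c w' 0 + c w' 2 * I) - cexp (c w' 1 * I)‖ * ‖cexp (-c w' 0 + c w' 2 * I) - cexp (c w' 1 * I)‖ : ℝ) : ℂ)
              else (1 - (Circle.exp (c w' 1 - c w' 0) : ℂ)) * (1 - (Circle.exp (c w' 2 - c w' 0) : ℂ)) * (1 - (Circle.exp (c w' 2 - c w' 1) : ℂ)))) =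
      ((‖cexp (x + p w 0 * I) - cexp (p w 1 * I)‖ * ‖cexp (-x + p w 0 * I) - cexp (p w 1 * I)‖ : ℝ) : ℂ) *
        ∏ w' ∈ Finset.univ.erase w,
          ((if w' ∈ S then (1 : ℂ) else (Circle.exp (p w' 0 - p w' 2) : ℂ)) *
            (if w' ∈ S then
                ((|Real.exp (p w' 0) - Real.exp (-p w' 0)| *
                  ‖cexp (p w' 0 + p w' 2 * I) - cexp (p w' 1 * I)‖ * ‖cexp (-p w' 0 + p w' 2 * I) - cexp (p w' 1 * I)‖ : ℝ) : ℂ)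
              else (1 - (Circle.exp (p w' 1 - p w' 0) : ℂ)) * (1 - (Circle.exp (p w' 2 - p w' 0) : ℂ)) * (1 - (Circle.exp (p w' 2 - p w' 1) : ℂ)))) := by
  have hcu : c = Function.update p w (c w) := by
    funext w'
    by_cases hw' : w' = w
    · subst hw'; rw [Function.update_self]
    · rw [Function.update_of_ne hw', hc w' hw']
  have hρ : archERhoG (insert w S) c = ∏ w' ∈ Finset.univ.erase w, (if w' ∈ S then (1 : ℂ) else (Circle.exp (p w' 0 - p w' 2) : ℂ)) := by
    rw [hcu, archERhoG_insert_update, ← archERhoG_insert_cayRay_eq S w p 0, cayRay_eq_update, archERhoG_insert_update]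
  have hfro : (∏ w' ∈ Finset.univ.erase w,
      (if w' ∈ insert w S then
          ((|Real.exp (c w' 0) - Real.exp (-c w' 0)| *
            ‖cexp (c w' 0 + c w' 2 * I) - cexp (c w' 1 * I)‖ * ‖cexp (-c w' 0 + c w' 2 * I) - cexp (c w' 1 * I)‖ : ℝ) : ℂ)
        else (1 - (Circle.exp (c w' 1 - c w' 0) : ℂ)) * (1 - (Circle.exp (c w' 2 - c w' 0) : ℂ)) * (1 - (Circle.exp (c w' 2 - c w' 1) : ℂ)))) =
      ∏ w' ∈ Finset.univ.erase w,
        (if w' ∈ S then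
            ((|Real.exp (p w' 0) - Real.exp (-p w' 0)| *
              ‖cexp (p w' 0 + p w' 2 * I) - cexp (p w' 1 * I)‖ * ‖cexp (-p w' 0 + p w' 2 * I) - cexp (p w' 1 * I)‖ : ℝ) : ℂ)
          else (1 - (Circle.exp (p w' 1 - p w' 0) : ℂ)) * (1 - (Circle.exp (p w' 2 - p w' 0) : ℂ)) * (1 - (Circle.exp (p w' 2 - p w' 1) : ℂ))) := by
    refine Finset.prod_congr rfl fun w' hw' => ?_
    have hne : w' ≠ w := Finset.ne_of_mem_erase hw'
    rw [hc w' hne]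
    by_cases hS : w' ∈ S
    · rw [if_pos (Finset.mem_insert_of_mem hS), if_pos hS]
    · rw [if_neg (fun h => (Finset.mem_insert.1 h).elim hne hS), if_neg hS]
  rw [hρ, hfro, h0, h1, h2, Finset.prod_mul_distrib]
  ring

end Ray

/-! ## §4 Closed forms of the two wall factors; smoothness and the value of `R♯` at the Cayley point -/

section Closed

variable {W : Type*} [Fintype W] [DecidableEq W]

/-- **`R p = ν ↦ i·(2cos ν − 2cos(θ − φ))·Π p`** — the closed form of ★ (c-wall)'s compact wall factor (§1). [cite: Rogawski1990, §8.2 p. 122] [cite: Shelstad1979, Lemma 4.3 (p. 25)] -/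
theorem wallFactorR_eq_two_cos_sub (S : Finset W) (w : W) (p : W → Fin 3 → ℝ) :
    (fun ν : ℝ =>
      I * ((Circle.exp ν : ℂ) * ((1 - (Circle.exp (p w 1 - p w 0 - ν) : ℂ)) * (1 - (Circle.exp (p w 0 - ν - p w 1) : ℂ)))) *
        ∏ w' ∈ Finset.univ.erase w,
          ((if w' ∈ S then (1 : ℂ) else (Circle.exp (p w' 0 - p w' 2) : ℂ)) *
            (if w' ∈ S then
                ((|Real.exp (p w' 0) - Real.exp (-p w' 0)| *
                  ‖cexp (p w' 0 + p w' 2 * I) - cexp (p w' 1 * I)‖ * ‖cexp (-p w' 0 + p w' 2 * I) - cexp (p w' 1 * I)‖ : ℝ) : ℂ)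
              else (1 - (Circle.exp (p w' 1 - p w' 0) : ℂ)) * (1 - (Circle.exp (p w' 2 - p w' 0) : ℂ)) * (1 - (Circle.exp (p w' 2 - p w' 1) : ℂ))))) =
      fun ν : ℝ => I * ((2 * Real.cos ν - 2 * Real.cos (p w 0 - p w 1) : ℝ) : ℂ) *
        ∏ w' ∈ Finset.univ.erase w,
          ((if w' ∈ S then (1 : ℂ) else (Circle.exp (p w' 0 - p w' 2) : ℂ)) *
            (if w' ∈ S then
                ((|Real.exp (p w' 0) - Real.exp (-p w' 0)| *
                  ‖cexp (p w' 0 + p w' 2 * I) - cexp (p w' 1 * I)‖ * ‖cexp (-p w' 0 + p w' 2 * I) - cexp (p w' 1 * I)‖ : ℝ) : ℂ)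
              else (1 - (Circle.exp (p w' 1 - p w' 0) : ℂ)) * (1 - (Circle.exp (p w' 2 - p w' 0) : ℂ)) * (1 - (Circle.exp (p w' 2 - p w' 1) : ℂ)))) := by
  funext ν
  rw [coe_circleExp_mul_one_sub_mul_one_sub_eq_two_cos_sub (p w 0) (p w 1) ν]

/-- **`R♯ p = x ↦ (2cosh x − 2cos(θ − φ))·Π p`** — the closed form of the split wall factor (§1); this is SPEC-I3 §5's `R″ p x = (2cosh x − 2cos(p w 0 − p w 1))·Π p`.
[cite: Rogawski1990, §8.2 p. 119] [cite: Shelstad1979, Lemma 4.3 (p. 25)] -/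
theorem splitWallFactorR_eq_two_cosh_sub (S : Finset W) (w : W) (p : W → Fin 3 → ℝ) :
    (fun x : ℝ =>
      ((‖cexp (x + p w 0 * I) - cexp (p w 1 * I)‖ * ‖cexp (-x + p w 0 * I) - cexp (p w 1 * I)‖ : ℝ) : ℂ) *
        ∏ w' ∈ Finset.univ.erase w,
          ((if w' ∈ S then (1 : ℂ) else (Circle.exp (p w' 0 - p w' 2) : ℂ)) *
            (if w' ∈ S then
                ((|Real.exp (p w' 0) - Real.exp (-p w' 0)| *
                  ‖cexp (p w' 0 + p w' 2 * I) - cexp (p w' 1 * I)‖ * ‖cexp (-p w' 0 + p w' 2 * I) - cexp (p w' 1 * I)‖ : ℝ) : ℂ)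
              else (1 - (Circle.exp (p w' 1 - p w' 0) : ℂ)) * (1 - (Circle.exp (p w' 2 - p w' 0) : ℂ)) * (1 - (Circle.exp (p w' 2 - p w' 1) : ℂ))))) =
      fun x : ℝ => ((2 * Real.cosh x - 2 * Real.cos (p w 0 - p w 1) : ℝ) : ℂ) *
        ∏ w' ∈ Finset.univ.erase w,
          ((if w' ∈ S then (1 : ℂ) else (Circle.exp (p w' 0 - p w' 2) : ℂ)) *
            (if w' ∈ S then
                ((|Real.exp (p w' 0) - Real.exp (-p w' 0)| *
                  ‖cexp (p w' 0 + p w' 2 * I) - cexp (p w' 1 * I)‖ * ‖cexp (-p w' 0 + p w' 2 * I) - cexp (p w' 1 * I)‖ : ℝ) : ℂ)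
              else (1 - (Circle.exp (p w' 1 - p w' 0) : ℂ)) * (1 - (Circle.exp (p w' 2 - p w' 0) : ℂ)) * (1 - (Circle.exp (p w' 2 - p w' 1) : ℂ)))) := by
  funext x
  rw [norm_mul_norm_eq_two_cosh_sub_two_cos x (p w 0) (p w 1)]

/-- **`R♯ p` IS SMOOTH on `ℝ`** (through the Cayley point `x = 0`: `2cosh x − 2cos δ` is entire, the frozen product is constant). [cite: Shelstad1979, Lemma 4.3 (p. 25)]
[cite: Varadarajan1989, §6.4 Thm 23] -/
theorem contDiff_splitWallFactorR (S : Finset W) (w : W) (p : W → Fin 3 → ℝ) :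
    ContDiff ℝ ∞ (fun x : ℝ =>
      ((‖cexp (x + p w 0 * I) - cexp (p w 1 * I)‖ * ‖cexp (-x + p w 0 * I) - cexp (p w 1 * I)‖ : ℝ) : ℂ) *
        ∏ w' ∈ Finset.univ.erase w,
          ((if w' ∈ S then (1 : ℂ) else (Circle.exp (p w' 0 - p w' 2) : ℂ)) *
            (if w' ∈ S then
                ((|Real.exp (p w' 0) - Real.exp (-p w' 0)| *
                  ‖cexp (p w' 0 + p w' 2 * I) - cexp (p w' 1 * I)‖ * ‖cexp (-p w' 0 + p w' 2 * I) - cexp (p w' 1 * I)‖ : ℝ) : ℂ)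
              else (1 - (Circle.exp (p w' 1 - p w' 0) : ℂ)) * (1 - (Circle.exp (p w' 2 - p w' 0) : ℂ)) * (1 - (Circle.exp (p w' 2 - p w' 1) : ℂ))))) := by
  rw [splitWallFactorR_eq_two_cosh_sub]
  exact (contDiff_ofReal_two_cosh_sub (p w 0 - p w 1)).mul contDiff_const

/-- **`i · R♯ p 0 = R p 0`**: at the wall ∕ Cayley point the two cofactors agree up to the factor `i` of `R` (`2cosh 0 − 2cos δ = 2cos 0 − 2cos δ`; order-`0` instance of §5,
cf. ★ `I_mul_archERhoG_insert_hcCayPt_mul_splitCofactor_eq`). [cite: Shelstad1979, Lemma 4.3 (p. 25)] [cite: Rogawski1990, §8.2 pp. 119, 122] -/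
theorem I_mul_splitWallFactorR_zero_eq (S : Finset W) (w : W) (p : W → Fin 3 → ℝ) :
    I * (((‖cexp ((0 : ℝ) + p w 0 * I) - cexp (p w 1 * I)‖ * ‖cexp (-(0 : ℝ) + p w 0 * I) - cexp (p w 1 * I)‖ : ℝ) : ℂ) *
        ∏ w' ∈ Finset.univ.erase w,
          ((if w' ∈ S then (1 : ℂ) else (Circle.exp (p w' 0 - p w' 2) : ℂ)) *
            (if w' ∈ S then
                ((|Real.exp (p w' 0) - Real.exp (-p w' 0)| *
                  ‖cexp (p w' 0 + p w' 2 * I) - cexp (p w' 1 * I)‖ * ‖cexp (-p w' 0 + p w' 2 * I) - cexp (p w' 1 * I)‖ : ℝ) : ℂ)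
              else (1 - (Circle.exp (p w' 1 - p w' 0) : ℂ)) * (1 - (Circle.exp (p w' 2 - p w' 0) : ℂ)) * (1 - (Circle.exp (p w' 2 - p w' 1) : ℂ))))) =
      I * ((Circle.exp (0 : ℝ) : ℂ) * ((1 - (Circle.exp (p w 1 - p w 0 - 0) : ℂ)) * (1 - (Circle.exp (p w 0 - 0 - p w 1) : ℂ)))) *
        ∏ w' ∈ Finset.univ.erase w,
          ((if w' ∈ S then (1 : ℂ) else (Circle.exp (p w' 0 - p w' 2) : ℂ)) *
            (if w' ∈ S then
                ((|Real.exp (p w' 0) - Real.exp (-p w' 0)| *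
                  ‖cexp (p w' 0 + p w' 2 * I) - cexp (p w' 1 * I)‖ * ‖cexp (-p w' 0 + p w' 2 * I) - cexp (p w' 1 * I)‖ : ℝ) : ℂ)
              else (1 - (Circle.exp (p w' 1 - p w' 0) : ℂ)) * (1 - (Circle.exp (p w' 2 - p w' 0) : ℂ)) * (1 - (Circle.exp (p w' 2 - p w' 1) : ℂ)))) := by
  rw [norm_mul_norm_eq_two_cosh_sub_two_cos 0 (p w 0) (p w 1), coe_circleExp_mul_one_sub_mul_one_sub_eq_two_cos_sub (p w 0) (p w 1) 0, Real.cosh_zero, Real.cos_zero]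
  ring

/-- **`R♯ p 0 ≠ 0` at a SEMIREGULAR wall point** (`i·R♯ p 0 = R p 0 ≠ 0`, ★ `wallFactorR_zero_ne_zero_of_hcSemireg`). [cite: Shelstad1979, §4 p. 22; Prop. 4.5 (p. 26)] -/
theorem splitWallFactorR_zero_ne_zero_of_hcSemireg (S : Finset W) {w : W} {p : W → Fin 3 → ℝ} (hp : HcSemireg S w 0 2 p) :
    ((‖cexp ((0 : ℝ) + p w 0 * I) - cexp (p w 1 * I)‖ * ‖cexp (-(0 : ℝ) + p w 0 * I) - cexp (p w 1 * I)‖ : ℝ) : ℂ) *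
        ∏ w' ∈ Finset.univ.erase w,
          ((if w' ∈ S then (1 : ℂ) else (Circle.exp (p w' 0 - p w' 2) : ℂ)) *
            (if w' ∈ S then
                ((|Real.exp (p w' 0) - Real.exp (-p w' 0)| *
                  ‖cexp (p w' 0 + p w' 2 * I) - cexp (p w' 1 * I)‖ * ‖cexp (-p w' 0 + p w' 2 * I) - cexp (p w' 1 * I)‖ : ℝ) : ℂ)
              else (1 - (Circle.exp (p w' 1 - p w' 0) : ℂ)) * (1 - (Circle.exp (p w' 2 - p w' 0) : ℂ)) * (1 - (Circle.exp (p w' 2 - p w' 1) : ℂ)))) ≠ 0 := by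
  intro h
  have h0 := wallFactorR_zero_ne_zero_of_hcSemireg S hp
  rw [← I_mul_splitWallFactorR_zero_eq S w p, h, mul_zero] at h0
  exact h0 rfl

end Closed

/-! ## §5 (B-wick) The cofactor Wick identity -/

section Wick

variable {W : Type*} [Fintype W] [DecidableEq W]

/-- **(B-wick) `iteratedDeriv a (R p) 0 = i^{a+1} · iteratedDeriv a (R♯ p) 0`** for EVERY order `a` (`R p` = ★ (c-wall) :54's compact wall factor along the normal, `R♯ p` =
§3's split wall factor along the `x`-ray): `R p = i·(2cos ν − 2cos δ)·Π p`, `R♯ p = (2cosh x − 2cos δ)·Π p` (§4) and `(2cos)⁽ᵃ⁾(0) = iᵃ·(2cosh)⁽ᵃ⁾(0)` (§2); both sides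
vanish for odd `a`.  With (B-norm)'s Leibniz expansion on the compact chart and `∂ₓⁿ(K″·R♯ p·Λ_f)(0)` on the Cayley chart this makes the jump constant `jc′ S w 0 2`
order-independent, the power `iᵃ` being exactly ★ `hcCayScalar = i^{#normal letters}`. [cite: Shelstad1979, Lemma 4.3 (p. 25); Prop. 4.5 (p. 26)]
[cite: Varadarajan1989, §6.4 Thm 24] [cite: Rogawski1990, §8.2 pp. 119–124] -/
theorem iteratedDeriv_wallFactorR_zero_eq (S : Finset W) (w : W) (p : W → Fin 3 → ℝ) (a : ℕ) :
    iteratedDeriv a (fun ν : ℝ =>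
      I * ((Circle.exp ν : ℂ) * ((1 - (Circle.exp (p w 1 - p w 0 - ν) : ℂ)) * (1 - (Circle.exp (p w 0 - ν - p w 1) : ℂ)))) *
        ∏ w' ∈ Finset.univ.erase w,
          ((if w' ∈ S then (1 : ℂ) else (Circle.exp (p w' 0 - p w' 2) : ℂ)) *
            (if w' ∈ S then
                ((|Real.exp (p w' 0) - Real.exp (-p w' 0)| *
                  ‖cexp (p w' 0 + p w' 2 * I) - cexp (p w' 1 * I)‖ * ‖cexp (-p w' 0 + p w' 2 * I) - cexp (p w' 1 * I)‖ : ℝ) : ℂ)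
              else (1 - (Circle.exp (p w' 1 - p w' 0) : ℂ)) * (1 - (Circle.exp (p w' 2 - p w' 0) : ℂ)) * (1 - (Circle.exp (p w' 2 - p w' 1) : ℂ))))) 0 =
      I ^ (a + 1) * iteratedDeriv a (fun x : ℝ =>
        ((‖cexp (x + p w 0 * I) - cexp (p w 1 * I)‖ * ‖cexp (-x + p w 0 * I) - cexp (p w 1 * I)‖ : ℝ) : ℂ) *
          ∏ w' ∈ Finset.univ.erase w,
            ((if w' ∈ S then (1 : ℂ) else (Circle.exp (p w' 0 - p w' 2) : ℂ)) *
              (if w' ∈ S then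
                  ((|Real.exp (p w' 0) - Real.exp (-p w' 0)| *
                    ‖cexp (p w' 0 + p w' 2 * I) - cexp (p w' 1 * I)‖ * ‖cexp (-p w' 0 + p w' 2 * I) - cexp (p w' 1 * I)‖ : ℝ) : ℂ)
                else (1 - (Circle.exp (p w' 1 - p w' 0) : ℂ)) * (1 - (Circle.exp (p w' 2 - p w' 0) : ℂ)) * (1 - (Circle.exp (p w' 2 - p w' 1) : ℂ))))) 0 := by
  rw [wallFactorR_eq_two_cos_sub, splitWallFactorR_eq_two_cosh_sub, iteratedDeriv_mul_const_field, iteratedDeriv_mul_const_field, iteratedDeriv_const_mul_field,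
    iteratedDeriv_ofReal_two_cos_sub_zero_eq_I_pow_mul, pow_succ]
  ring

/-- **`R p 0 ∕ R♯ p 0 = i`** at a semiregular wall point (§4: `i·R♯ p 0 = R p 0`, `R♯ p 0 ≠ 0`) — the `a = 0` Wick factor, as F0P3a-p08 (g23) asked it exported.
[cite: Shelstad1979, Lemma 4.3 (p. 25)] [cite: Rogawski1990, §8.2 pp. 119, 122] -/
theorem wallFactorR_zero_div_splitWallFactorR_zero_eq_I (S : Finset W) {w : W} {p : W → Fin 3 → ℝ} (hp : HcSemireg S w 0 2 p) :
    (I * ((Circle.exp (0 : ℝ) : ℂ) * ((1 - (Circle.exp (p w 1 - p w 0 - 0) : ℂ)) * (1 - (Circle.exp (p w 0 - 0 - p w 1) : ℂ)))) *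
        ∏ w' ∈ Finset.univ.erase w,
          ((if w' ∈ S then (1 : ℂ) else (Circle.exp (p w' 0 - p w' 2) : ℂ)) *
            (if w' ∈ S then
                ((|Real.exp (p w' 0) - Real.exp (-p w' 0)| *
                  ‖cexp (p w' 0 + p w' 2 * I) - cexp (p w' 1 * I)‖ * ‖cexp (-p w' 0 + p w' 2 * I) - cexp (p w' 1 * I)‖ : ℝ) : ℂ)
              else (1 - (Circle.exp (p w' 1 - p w' 0) : ℂ)) * (1 - (Circle.exp (p w' 2 - p w' 0) : ℂ)) * (1 - (Circle.exp (p w' 2 - p w' 1) : ℂ))))) /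
      (((‖cexp ((0 : ℝ) + p w 0 * I) - cexp (p w 1 * I)‖ * ‖cexp (-(0 : ℝ) + p w 0 * I) - cexp (p w 1 * I)‖ : ℝ) : ℂ) *
        ∏ w' ∈ Finset.univ.erase w,
          ((if w' ∈ S then (1 : ℂ) else (Circle.exp (p w' 0 - p w' 2) : ℂ)) *
            (if w' ∈ S then
                ((|Real.exp (p w' 0) - Real.exp (-p w' 0)| *
                  ‖cexp (p w' 0 + p w' 2 * I) - cexp (p w' 1 * I)‖ * ‖cexp (-p w' 0 + p w' 2 * I) - cexp (p w' 1 * I)‖ : ℝ) : ℂ)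
              else (1 - (Circle.exp (p w' 1 - p w' 0) : ℂ)) * (1 - (Circle.exp (p w' 2 - p w' 0) : ℂ)) * (1 - (Circle.exp (p w' 2 - p w' 1) : ℂ))))) = I := by
  rw [div_eq_iff (splitWallFactorR_zero_ne_zero_of_hcSemireg S hp), I_mul_splitWallFactorR_zero_eq S w p]

end Wick

end Literature.NumberTheory.Rogawski1990

end
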